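import Summits.Ventures.CertifiedManyBodySolver.Upper.IntervalReaderObservableRows
import Summits.Ventures.CertifiedManyBodySolver.Upper.IntervalReaderEmbedClaimNode

/-!
# Ventures/CertifiedManyBodySolver — Upper/IntervalReaderEmbedObsRows.lean: the `docc` / hopping rows from the
# EMBED-layout bytes
(part 38 of the Theorem-H1′ package; parts 33–35 = the embed layout, parts 36–37 = the observable rows, merge layout;
part 39 `IntervalReaderEmbedObsClaimNode` = the nine- and eleven-conjunct nodes from the embed bytes)

HONEST FRAMING: first certified bounds; not a superconductivity verdict; every number certified (two readers)
or labelled float.  Observable windows of one certified finite-box vector are certified variational statements about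
ONE vector; never a sign of order, never an order-parameter word (LADDER v1.17 (i)).  This file is a DICTIONARY between
two layouts of one reader; it certifies no number and moves no row.

Every W5 read of record is the EMBED layout (`JOB_LAYOUT=embed`: `2ab` l3core sites, the second mode of each a
never-occupied dummy; parts 33–35).  The `JOB_OBS` sweeps (`docc_model`, `khop_model`, ref-2c g29 P14) run there
over `ModeQuadModel.dilated()` exactly like the `H̃`-sweep, i.e. over part 34's dilated tables at
`(M, U, μ) = (0, 1, 0)` (`docc`) and `(𝒦^ḡ_G, 0, 0)` (hopping word of the box graph `G`).  Hence, for the un-dilated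
witness `ψ̃ = undilate e′ (mpsOpenVar N A l r)` of part 33 and the producers' real sign gauge `g = ±1`:

* **`doccWindow_of_embedReader`**, **`hoppingWindow_of_embedReader`** — part 36's windows for the embed sweep
  (chain window of part 33 §R → part 34's `inner_dilQuadratic_eq_quadWordSum` → `Γ(dilOrb)` / `V_∅` of part 33 →
  ird-5's closed forms `S′ᴴ(Σ n↑n↓)S′ = N↑ − Σ n↑n↓`, `S′ᴴ·hamiltonian G t 0·S′ = dΓ(𝒦^ḡ_G)`);
* part 39 then composes them with part 35's bytes into the NINE- / ELEVEN-conjunct nodes.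

Inputs outside the bytes, unchanged: the contractions (kit), the machine premises (A1)/(A2), the code tables =
`quadAutomaton` over the dilated tables by value (`dilNN 0 e′ = 0`; `dilOnSite 𝒦^ḡ 0 0 e′` = the zero diagonal of a
loop-free graph), the zero dummy slices `A′ j 2 = A′ j 3 = 0`, the by-value tests, the F-V2 labels, `n_lo > 0`.
-/

noncomputable section

-- The dilated orbital type `Orb (Orb Λ)` is a twice-nested `Lex` synonym (see part 35).
set_option synthInstance.maxSize 1024

open Matrix Finset WithLp
open scoped BigOperators ComplexOrder Matrix.Norms.L2Operator

namespace Summit.Ventures.CertifiedManyBodySolver.Upper.IntervalReader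

open Literature.MathematicalPhysics.QuantumLattice
open Literature.MathematicalPhysics.QuantumLattice.JordanWigner
open Literature.MathematicalPhysics.QuantumLattice.JWEmbed
open Literature.MathematicalPhysics.QuantumLattice.TwoCluster (HasParity)

/-! ## §O  The `docc` and hopping windows from the EMBED-layout bytes -/

section Windows

variable {a b N D : ℕ}

/-- **Embed-layout bytes of the `docc_model` sweep ⇒ the DOUBLE-OCCUPANCY window** of the un-dilated witness
(producers' frame): dilated tables at `(M, U, μ) = (0, 1, 0)`, the shared `Nrm` sweep, four by-value corner tests. -/
theorem doccWindow_of_embedReader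
    {g : Orb (Fin a ×ₗ Fin b) → ℂ} (hg : ∀ i, g i = 1 ∨ g i = -1) (e' : Fin N ≃ Orb (Fin a ×ₗ Fin b))
    (he' : ∀ i j, e' i < e' j ↔ i < j) (A : Fin N → MPSTensor 4 D) (hA2 : ∀ j, A j 2 = 0) (hA3 : ∀ j, A j 3 = 0)
    (l r : Fin D → ℂ) (κ : Fin N → ℝ) (hκ0 : ∀ k, 0 ≤ κ k)
    (hκ : ∀ k (z : EuclideanSpace ℂ (Fin D)), ∑ s, ‖toLp 2 (A k s *ᵥ ofLp z)‖ ^ 2 ≤ κ k * ‖z‖ ^ 2)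
    (Md : Fin N → QState N → QState N → ℝ) (hMd0 : ∀ k b' c, 0 ≤ Md k b' c)
    (hMdrow : ∀ k b' c s, ∑ s', ‖quadAutomaton (dGammaHop (orbPullback e' (dilMatrix
      (0 : Matrix (Orb (Fin a ×ₗ Fin b)) (Orb (Fin a ×ₗ Fin b)) ℂ)))) (dilNN 1 e') (dilOnSite (0 : Matrix (Orb (Fin a ×ₗ Fin b)) (Orb (Fin a ×ₗ Fin b)) ℂ) 1 0 e') k b' c s s'‖ ≤ Md k b' c)
    (hMdcol : ∀ k b' c s', ∑ s, ‖quadAutomaton (dGammaHop (orbPullback e' (dilMatrix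
      (0 : Matrix (Orb (Fin a ×ₗ Fin b)) (Orb (Fin a ×ₗ Fin b)) ℂ)))) (dilNN 1 e') (dilOnSite (0 : Matrix (Orb (Fin a ×ₗ Fin b)) (Orb (Fin a ×ₗ Fin b)) ℂ) 1 0 e') k b' c s s'‖ ≤ Md k b' c)
    (YX : Fin (N + 1) → QState N → Matrix (Fin D) (Fin D) ℂ) (ρX : Fin N → QState N → ℝ)
    (hρX : ∀ (k : Fin N) (c : QState N),
      ‖YX k.succ c - ∑ b', transferOp (A k) (quadAutomaton (dGammaHop (orbPullback e' (dilMatrix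
      (0 : Matrix (Orb (Fin a ×ₗ Fin b)) (Orb (Fin a ×ₗ Fin b)) ℂ)))) (dilNN 1 e') (dilOnSite (0 : Matrix (Orb (Fin a ×ₗ Fin b)) (Orb (Fin a ×ₗ Fin b)) ℂ) 1 0 e') k b' c) (YX k.castSucc b')‖ ≤ ρX k c)
    (radX : Fin (N + 1) → QState N → ℝ)
    (hradX0 : ∀ b', ‖YX 0 b' -
      (Pi.single QState.start (vecMulVec (star l) l) : QState N → Matrix (Fin D) (Fin D) ℂ) b'‖ ≤ radX 0 b')
    (hradX : ∀ (k : Fin N) (c : QState N), ∑ b', Md k b' c * κ k * radX k.castSucc b' + ρX k c ≤ radX k.succ c)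
    (YN : Fin (N + 1) → Matrix (Fin D) (Fin D) ℂ) (ρN : Fin N → ℝ)
    (hρN : ∀ k : Fin N, ‖YN k.succ - transferOp (A k) 1 (YN k.castSucc)‖ ≤ ρN k)
    (radN : Fin (N + 1) → ℝ) (hrN0 : ‖YN 0 - vecMulVec (star l) l‖ ≤ radN 0)
    (hrN : ∀ k : Fin N, 1 * κ k * radN k.castSucc + ρN k ≤ radN k.succ)
    (dlo dhi : ℝ)
    (hd1 : dlo * ((star r ⬝ᵥ (YN (Fin.last N) *ᵥ r)).re - (∑ i, ‖r i‖) * (∑ i, ‖r i‖) * radN (Fin.last N)) ≤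
      (star r ⬝ᵥ (YX (Fin.last N) QState.fin *ᵥ r)).re - (∑ i, ‖r i‖) * (∑ i, ‖r i‖) * radX (Fin.last N) QState.fin)
    (hd2 : dlo * ((star r ⬝ᵥ (YN (Fin.last N) *ᵥ r)).re + (∑ i, ‖r i‖) * (∑ i, ‖r i‖) * radN (Fin.last N)) ≤
      (star r ⬝ᵥ (YX (Fin.last N) QState.fin *ᵥ r)).re - (∑ i, ‖r i‖) * (∑ i, ‖r i‖) * radX (Fin.last N) QState.fin)
    (hd3 : (star r ⬝ᵥ (YX (Fin.last N) QState.fin *ᵥ r)).re +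
        (∑ i, ‖r i‖) * (∑ i, ‖r i‖) * radX (Fin.last N) QState.fin ≤
      dhi * ((star r ⬝ᵥ (YN (Fin.last N) *ᵥ r)).re - (∑ i, ‖r i‖) * (∑ i, ‖r i‖) * radN (Fin.last N)))
    (hd4 : (star r ⬝ᵥ (YX (Fin.last N) QState.fin *ᵥ r)).re +
        (∑ i, ‖r i‖) * (∑ i, ‖r i‖) * radX (Fin.last N) QState.fin ≤
      dhi * ((star r ⬝ᵥ (YN (Fin.last N) *ᵥ r)).re + (∑ i, ‖r i‖) * (∑ i, ‖r i‖) * radN (Fin.last N))) :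
    dlo * (star (undilate e' (mpsOpenVar N A l r)) ⬝ᵥ undilate e' (mpsOpenVar N A l r)).re ≤
        (star (undilate e' (mpsOpenVar N A l r)) ⬝ᵥ
          (((partialParticleHole (spinDownOrbitals : Finset (Orb (Fin a ×ₗ Fin b))) * orbitalPhase g)ᴴ *
              (∑ x : Fin a ×ₗ Fin b, numberOp x 0 * numberOp x 1) *
              (partialParticleHole (spinDownOrbitals : Finset (Orb (Fin a ×ₗ Fin b))) * orbitalPhase g)) *ᵥ
            undilate e' (mpsOpenVar N A l r))).re ∧
      (star (undilate e' (mpsOpenVar N A l r)) ⬝ᵥ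
          (((partialParticleHole (spinDownOrbitals : Finset (Orb (Fin a ×ₗ Fin b))) * orbitalPhase g)ᴴ *
              (∑ x : Fin a ×ₗ Fin b, numberOp x 0 * numberOp x 1) *
              (partialParticleHole (spinDownOrbitals : Finset (Orb (Fin a ×ₗ Fin b))) * orbitalPhase g)) *ᵥ
            undilate e' (mpsOpenVar N A l r))).re ≤
        dhi * (star (undilate e' (mpsOpenVar N A l r)) ⬝ᵥ undilate e' (mpsOpenVar N A l r)).re := by
  have hg' : ∀ i, ‖g i‖ = 1 := fun i => by rcases hg i with h1 | h1 <;> simp [h1]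
  have hsupp := mpsOpenVar_eq_zero_of_dummy A l r hA2 hA3
  have hDc := wordSum_window_of_reader _ _ _ A l r κ hκ0 hκ Md hMd0 hMdrow hMdcol YX ρX hρX radX hradX0 hradX YN ρN hρN
    radN hrN0 hrN dlo dhi hd1 hd2 hd3 hd4
  have emb := jwEmbed_dilOrb_quadratic (a := a) (b := b) (0 : Matrix (Orb (Fin a ×ₗ Fin b)) (Orb (Fin a ×ₗ Fin b)) ℂ) 1 0
  have key := inner_dilQuadratic_eq_quadWordSum (0 : Matrix (Orb (Fin a ×ₗ Fin b)) (Orb (Fin a ×ₗ Fin b)) ℂ)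
    (fun _ _ => rfl) 1 0 e' he' (mpsOpenVar N A l r)
  simp only [dGamma_zero, Complex.ofReal_zero, zero_mul, zero_smul, sub_zero, Complex.ofReal_one, one_smul,
    zero_add] at emb key
  rw [gaugedShiba'_conjTranspose_conj_onSiteRepulsion hg', undilate_sandwich e' _ hsupp, emb, key,
    undilate_norm e' _ hsupp]
  exact hDc

/-- **Embed-layout bytes of the `khop_model` sweep ⇒ the HOPPING-WORD window** of a box graph `G` (any `t`) for the
un-dilated witness (producers' frame): dilated tables at `(M, U, μ) = (𝒦^ḡ_G, 0, 0)`, the shared `Nrm` sweep, four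
corner tests. -/
theorem hoppingWindow_of_embedReader (G : SimpleGraph (Fin a ×ₗ Fin b)) [DecidableRel G.Adj] (t : ℝ)
    {g : Orb (Fin a ×ₗ Fin b) → ℂ} (hg : ∀ i, g i = 1 ∨ g i = -1) (e' : Fin N ≃ Orb (Fin a ×ₗ Fin b))
    (he' : ∀ i j, e' i < e' j ↔ i < j) (A : Fin N → MPSTensor 4 D) (hA2 : ∀ j, A j 2 = 0) (hA3 : ∀ j, A j 3 = 0)
    (l r : Fin D → ℂ) (κ : Fin N → ℝ) (hκ0 : ∀ k, 0 ≤ κ k)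
    (hκ : ∀ k (z : EuclideanSpace ℂ (Fin D)), ∑ s, ‖toLp 2 (A k s *ᵥ ofLp z)‖ ^ 2 ≤ κ k * ‖z‖ ^ 2)
    (Mk : Fin N → QState N → QState N → ℝ) (hMk0 : ∀ k b' c, 0 ≤ Mk k b' c)
    (hMkrow : ∀ k b' c s, ∑ s', ‖quadAutomaton (dGammaHop (orbPullback e' (dilMatrix
      (Matrix.of fun i j : Orb (Fin a ×ₗ Fin b) => star (g i) * g j *
        bdgNambuMatrix (fun u v : Fin a ×ₗ Fin b => if G.Adj u v then -(t : ℂ) else 0) 0 0 i j)))) (dilNN 0 e') (dilOnSite (Matrix.of fun i j : Orb (Fin a ×ₗ Fin b) => star (g i) * g j *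
        bdgNambuMatrix (fun u v : Fin a ×ₗ Fin b => if G.Adj u v then -(t : ℂ) else 0) 0 0 i j) 0 0 e') k b' c s s'‖ ≤ Mk k b' c)
    (hMkcol : ∀ k b' c s', ∑ s, ‖quadAutomaton (dGammaHop (orbPullback e' (dilMatrix
      (Matrix.of fun i j : Orb (Fin a ×ₗ Fin b) => star (g i) * g j *
        bdgNambuMatrix (fun u v : Fin a ×ₗ Fin b => if G.Adj u v then -(t : ℂ) else 0) 0 0 i j)))) (dilNN 0 e') (dilOnSite (Matrix.of fun i j : Orb (Fin a ×ₗ Fin b) => star (g i) * g j *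
        bdgNambuMatrix (fun u v : Fin a ×ₗ Fin b => if G.Adj u v then -(t : ℂ) else 0) 0 0 i j) 0 0 e') k b' c s s'‖ ≤ Mk k b' c)
    (YK : Fin (N + 1) → QState N → Matrix (Fin D) (Fin D) ℂ) (ρK : Fin N → QState N → ℝ)
    (hρK : ∀ (k : Fin N) (c : QState N),
      ‖YK k.succ c - ∑ b', transferOp (A k) (quadAutomaton (dGammaHop (orbPullback e' (dilMatrix
      (Matrix.of fun i j : Orb (Fin a ×ₗ Fin b) => star (g i) * g j *
        bdgNambuMatrix (fun u v : Fin a ×ₗ Fin b => if G.Adj u v then -(t : ℂ) else 0) 0 0 i j)))) (dilNN 0 e') (dilOnSite (Matrix.of fun i j : Orb (Fin a ×ₗ Fin b) => star (g i) * g j *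
        bdgNambuMatrix (fun u v : Fin a ×ₗ Fin b => if G.Adj u v then -(t : ℂ) else 0) 0 0 i j) 0 0 e') k b' c) (YK k.castSucc b')‖ ≤ ρK k c)
    (radK : Fin (N + 1) → QState N → ℝ)
    (hradK0 : ∀ b', ‖YK 0 b' -
      (Pi.single QState.start (vecMulVec (star l) l) : QState N → Matrix (Fin D) (Fin D) ℂ) b'‖ ≤ radK 0 b')
    (hradK : ∀ (k : Fin N) (c : QState N), ∑ b', Mk k b' c * κ k * radK k.castSucc b' + ρK k c ≤ radK k.succ c)
    (YN : Fin (N + 1) → Matrix (Fin D) (Fin D) ℂ) (ρN : Fin N → ℝ)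
    (hρN : ∀ k : Fin N, ‖YN k.succ - transferOp (A k) 1 (YN k.castSucc)‖ ≤ ρN k)
    (radN : Fin (N + 1) → ℝ) (hrN0 : ‖YN 0 - vecMulVec (star l) l‖ ≤ radN 0)
    (hrN : ∀ k : Fin N, 1 * κ k * radN k.castSucc + ρN k ≤ radN k.succ)
    (klo khi : ℝ)
    (hk1 : klo * ((star r ⬝ᵥ (YN (Fin.last N) *ᵥ r)).re - (∑ i, ‖r i‖) * (∑ i, ‖r i‖) * radN (Fin.last N)) ≤
      (star r ⬝ᵥ (YK (Fin.last N) QState.fin *ᵥ r)).re - (∑ i, ‖r i‖) * (∑ i, ‖r i‖) * radK (Fin.last N) QState.fin)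
    (hk2 : klo * ((star r ⬝ᵥ (YN (Fin.last N) *ᵥ r)).re + (∑ i, ‖r i‖) * (∑ i, ‖r i‖) * radN (Fin.last N)) ≤
      (star r ⬝ᵥ (YK (Fin.last N) QState.fin *ᵥ r)).re - (∑ i, ‖r i‖) * (∑ i, ‖r i‖) * radK (Fin.last N) QState.fin)
    (hk3 : (star r ⬝ᵥ (YK (Fin.last N) QState.fin *ᵥ r)).re +
        (∑ i, ‖r i‖) * (∑ i, ‖r i‖) * radK (Fin.last N) QState.fin ≤
      khi * ((star r ⬝ᵥ (YN (Fin.last N) *ᵥ r)).re - (∑ i, ‖r i‖) * (∑ i, ‖r i‖) * radN (Fin.last N)))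
    (hk4 : (star r ⬝ᵥ (YK (Fin.last N) QState.fin *ᵥ r)).re +
        (∑ i, ‖r i‖) * (∑ i, ‖r i‖) * radK (Fin.last N) QState.fin ≤
      khi * ((star r ⬝ᵥ (YN (Fin.last N) *ᵥ r)).re + (∑ i, ‖r i‖) * (∑ i, ‖r i‖) * radN (Fin.last N))) :
    klo * (star (undilate e' (mpsOpenVar N A l r)) ⬝ᵥ undilate e' (mpsOpenVar N A l r)).re ≤
        (star (undilate e' (mpsOpenVar N A l r)) ⬝ᵥ
          (((partialParticleHole (spinDownOrbitals : Finset (Orb (Fin a ×ₗ Fin b))) * orbitalPhase g)ᴴ *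
              hamiltonian G t 0 *
              (partialParticleHole (spinDownOrbitals : Finset (Orb (Fin a ×ₗ Fin b))) * orbitalPhase g)) *ᵥ
            undilate e' (mpsOpenVar N A l r))).re ∧
      (star (undilate e' (mpsOpenVar N A l r)) ⬝ᵥ
          (((partialParticleHole (spinDownOrbitals : Finset (Orb (Fin a ×ₗ Fin b))) * orbitalPhase g)ᴴ *
              hamiltonian G t 0 *
              (partialParticleHole (spinDownOrbitals : Finset (Orb (Fin a ×ₗ Fin b))) * orbitalPhase g)) *ᵥ
            undilate e' (mpsOpenVar N A l r))).re ≤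
        khi * (star (undilate e' (mpsOpenVar N A l r)) ⬝ᵥ undilate e' (mpsOpenVar N A l r)).re := by
  have hg' : ∀ i, ‖g i‖ = 1 := fun i => by rcases hg i with h1 | h1 <;> simp [h1]
  have hsupp := mpsOpenVar_eq_zero_of_dummy A l r hA2 hA3
  have hKc := wordSum_window_of_reader _ _ _ A l r κ hκ0 hκ Mk hMk0 hMkrow hMkcol YK ρK hρK radK hradK0 hradK YN ρN hρN
    radN hrN0 hrN klo khi hk1 hk2 hk3 hk4
  have emb := jwEmbed_dilOrb_quadratic (a := a) (b := b)
    (Matrix.of fun i j : Orb (Fin a ×ₗ Fin b) => star (g i) * g j *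
      bdgNambuMatrix (fun u v : Fin a ×ₗ Fin b => if G.Adj u v then -(t : ℂ) else 0) 0 0 i j) 0 0
  have key := inner_dilQuadratic_eq_quadWordSum
    (Matrix.of fun i j : Orb (Fin a ×ₗ Fin b) => star (g i) * g j *
      bdgNambuMatrix (fun u v : Fin a ×ₗ Fin b => if G.Adj u v then -(t : ℂ) else 0) 0 0 i j)
    (gaugedHopNambu_symm_of_sign G t hg) 0 0 e' he' (mpsOpenVar N A l r)
  simp only [Complex.ofReal_zero, zero_mul, zero_smul, sub_zero, add_zero] at emb key
  rw [gaugedShiba'_conjTranspose_conj_hamiltonian_zero G t hg', undilate_sandwich e' _ hsupp, emb, key,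
    undilate_norm e' _ hsupp]
  exact hKc

end Windows

end Summit.Ventures.CertifiedManyBodySolver.Upper.IntervalReader

end
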